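import Summits.BirchSwinnertonDyer.BirchSwinnertonDyer.Theorems.KolyvaginRoadThreeRationalLiftSelmerDescent
import HarnessLib

/-!
# Route `KolyvaginRoadThree`, crux `ZhangSharpFrameAtThreeHL` (item stmt-BirchSwinnertonDyer-19574) — companion to
# `KolyvaginRoadThreeRationalLiftSelmerDescent`: at an ODD prime the quadratic-descent comparison map is an ISOMORPHISM
# `Sel_{p^∞}(E/ℚ) × Sel_{p^∞}(E^{(c)}/ℚ) ≃+ Sel_{p^∞}(E/K)` (cell `bsd-stepL`, seat `bsd-stepL-koly3b` g9)

`KolyvaginRoadThreeRationalLiftSelmerDescent` (koly3b g9) proved INJECTIVITY of T. Dokchitser's comparison map at odd `p`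
(kernel killed by `8`, `nsmul_eq_zero_of_comparisonMap_eq_zero`). The tree also has the cokernel killed by `8`
(`nsmul_mem_range_comparisonMap`); at odd `p` the target is `p`-primary, so the map is SURJECTIVE too. This file records the
bijection and the resulting additive isomorphism — the exact form, at odd `p`, of Dokchitser–Dokchitser 2010 Lemma 4.14 ∕
T. Dokchitser 2013 §4 (`X_p(E/K(√α)) = X_p(E/K) ⊕ X_p(E_α/K)` up to bounded torsion; no torsion at odd `p`). FACT-FREE; theorems
only; closes nothing (T7); not used by S1 (recorded for the quadratic-descent users of the tree). PARTITION: O2@3 (B10) × A1 ×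
crux 19574 × stub S1 (E′-side tools) — proves-glue.

References: [cite: DokchitserDokchitserAnnals2010, Lemma 4.14 (proof)] [cite: Dokchitser2013ParityNotes, §4].
-/

noncomputable section

open scoped Classical

namespace Summit.BirchSwinnertonDyer.Rank1Residual.X11b.Three.Koly.RationalLift

open WeierstrassCurve Literature.NumberTheory.EllipticCurves Literature.NumberTheory.QuadraticFields

variable (W : WeierstrassCurve ℚ) (K : Type) [Field K] [NumberField K] (h2 : Module.finrank ℚ K = 2)
  {θ : K} {c : ℚ} (hθ : θ ∉ Set.range (algebraMap ℚ K)) (hc : θ ^ 2 = algebraMap ℚ K c)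
  (p : ℕ) [Fact p.Prime] (hp2 : p ≠ 2)

include h2 hθ hc hp2 in
/-- **At an odd prime the comparison map is surjective**: its cokernel is killed by `8`
(`nsmul_mem_range_comparisonMap`) and `Sel_{p^∞}(E/K)` is `p`-primary; with `a·8 + b·p^k = 1` (Bézout) and `p^k s = 0`,
`s = a·(8s)` lies in the range. [cite: DokchitserDokchitserAnnals2010, Lemma 4.14 (proof)] -/
theorem comparisonMap_surjective_of_odd : Function.Surjective (comparisonMap W K hθ hc p) := by
  have hp : p.Prime := Fact.out
  intro s
  obtain ⟨x, hx⟩ := nsmul_mem_range_comparisonMap W K h2 hθ hc p s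
  obtain ⟨k, hk⟩ := exists_pow_nsmul_eq_zero_galH1Primary (W.baseChange K) p
    (s : galH1Primary (W.baseChange K) p)
  have hk' : p ^ k • s = 0 := Subtype.ext (by rw [AddSubmonoidClass.coe_nsmul, hk, ZeroMemClass.coe_zero])
  have hcop : IsCoprime ((8 : ℕ) : ℤ) ((p ^ k : ℕ) : ℤ) := by
    rw [Nat.isCoprime_iff_coprime]
    have h := ((Nat.coprime_primes Nat.prime_two hp).2 (Ne.symm hp2)).pow 3 k
    norm_num at h
    exact h
  obtain ⟨a, b, hab⟩ := hcop
  refine ⟨a • x, ?_⟩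
  have hpk : ((p ^ k : ℕ) : ℤ) • s = 0 := by rw [natCast_zsmul, hk']
  have h8 : ((8 : ℕ) : ℤ) • s = comparisonMap W K hθ hc p x := by rw [natCast_zsmul, hx]
  calc comparisonMap W K hθ hc p (a • x) = a • ((8 : ℕ) : ℤ) • s := by rw [map_zsmul, h8]
    _ = (a * ((8 : ℕ) : ℤ) + b * ((p ^ k : ℕ) : ℤ)) • s := by
        rw [add_zsmul, mul_zsmul, mul_zsmul, hpk, zsmul_zero, add_zero]
    _ = s := by rw [hab, one_zsmul]

include h2 hθ hc hp2 in
/-- **At an odd prime the comparison map `Sel_{p^∞}(E/ℚ) × Sel_{p^∞}(E^{(c)}/ℚ) → Sel_{p^∞}(E/K)` is bijective**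
(`K = ℚ(θ)`, `θ² = c`). [cite: DokchitserDokchitserAnnals2010, Lemma 4.14] [cite: Dokchitser2013ParityNotes, §4] -/
theorem comparisonMap_bijective_of_odd : Function.Bijective (comparisonMap W K hθ hc p) :=
  ⟨comparisonMap_injective_of_odd W K h2 hθ hc p hp2, comparisonMap_surjective_of_odd W K h2 hθ hc p hp2⟩

include h2 hθ hc hp2 in
/-- **`Sel_{p^∞}(E/K) ≅ Sel_{p^∞}(E/ℚ) ⊕ Sel_{p^∞}(E^{(c)}/ℚ)` at an odd prime** (`K = ℚ(θ)`, `θ² = c`): the quadratic descent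
of the `p^∞`-Selmer group is exact, not only up to bounded torsion, when `p` is odd.
[cite: DokchitserDokchitserAnnals2010, Lemma 4.14] [cite: Dokchitser2013ParityNotes, §4, proof of the Theorem "[Squarity, NekIV, Kurast]"] -/
theorem nonempty_addEquiv_selmerGroupPInfty_prod_twist_of_odd :
    Nonempty (selmerGroupPInfty W p × selmerGroupPInfty (W.quadraticTwist c) p ≃+
      selmerGroupPInfty (W.baseChange K) p) :=
  ⟨AddEquiv.ofBijective (comparisonMap W K hθ hc p) (comparisonMap_bijective_of_odd W K h2 hθ hc p hp2)⟩

end Summit.BirchSwinnertonDyer.Rank1Residual.X11b.Three.Koly.RationalLift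

end
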